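import Summits.KontsevichZagierPeriods.KontsevichZagierPeriods.Theorems.RootDecompQuadraticDescentMerge

/-!
# `FixedDimMerge 1` — the decided TOY instance (cell decomp-kz, lens 6, gen 4)

`Toy.toyMerge : of A + of B − of G ∈ KZ.relations` with `A = [(0,√2), dt]` (domain `J = {0 < t, t² < 2}` over `ℚ`),
`B = [(0,1), ds/(1+s)]`, `G = [(0,√2), (t²+2t+2) dt/(t²+2)]`, all `IsRational`: rule 1b on `J`
(`[G] − [A] − [W]`, `W = [(0,√2), 2t dt/(t²+2)]`) + rule 2 along the `ℚ`-rational chart `Φ(t) = t²/2`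
(`exists_squareChart`: semialgebraic, `det = t`, injective on `J`, `Φ''J = (0,1)`) giving `[W] − [B]`;
`value_G : G.value = A.value + B.value` by soundness; `fixedDimMerge_instance`. Split off the MERGE package
`RootDecompQuadraticDescentMerge.lean` for the ≤ 400-line lint. [Kontsevich–Zagier 2001, §1.2 rules 1)–2)]
-/

noncomputable section

set_option linter.dupNamespace false

open MeasureTheory Set
open MvPolynomial (aeval X C)
open Literature.ModelTheory.ExponentialFields (IsSemialgebraic isSemialgebraic_empty tarski_seidenberg_real_holds)

namespace Summit.KontsevichZagierPeriods.KontsevichZagierPeriods.Theorems.RootDecompQuadraticDescentMerge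

open Literature.NumberTheory.Transcendental
open Literature.NumberTheory.Transcendental.KZ

/-! ### Toy: a decided instance of `FixedDimMerge 1`

`[(0,√2), dt] + [(0,1), ds/(1+s)] − [(0,√2), (t²+2t+2) dt/(t²+2)] ∈ KZ.relations`: the two KZ-rational
representations `A` (value `√2`) and `B` (value `log 2`) have different fractions and different domains and do
not GLUE into one `IsRational` representation; they MERGE inside dimension `1` into `G` by rule 1b on the
common domain `(0,√2)` after the `ℚ`-rational substitution `s = t²/2` (rule 2). A trick, not a recipe. -/

namespace Toy



/-- `J = (0, √2) ⊂ ℝ¹`, written over `ℚ` as `{0 < t, t² < 2}`. -/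
def J : Set (Fin 1 → ℝ) := {t | 0 < t 0 ∧ t 0 ^ 2 < 2}

/-- `I01 = (0, 1) ⊂ ℝ¹`. -/
def I01 : Set (Fin 1 → ℝ) := {t | 0 < t 0 ∧ t 0 < 1}

/-- `J = {0 < t, t² < 2}` is `ℚ`-semialgebraic. [BCR1998 §2.2] -/
lemma isSemialgebraic_J : IsSemialgebraic ℚ J := by
  have h := isSemialgebraic_setOf_forall_aeval_pos ![(X 0 : MvPolynomial (Fin 1) ℚ), C 2 - X 0 ^ 2]
  convert h using 1
  ext t
  simp only [J, mem_setOf_eq, Fin.forall_fin_succ, Matrix.cons_val_zero, Matrix.cons_val_succ, map_sub,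
    map_pow, MvPolynomial.aeval_X, MvPolynomial.aeval_C, eq_ratCast, sub_pos, IsEmpty.forall_iff, and_true]
  norm_num

/-- `(0,1)` is `ℚ`-semialgebraic. [BCR1998 §2.2] -/
lemma isSemialgebraic_I01 : IsSemialgebraic ℚ I01 := by
  have h := isSemialgebraic_setOf_forall_aeval_pos ![(X 0 : MvPolynomial (Fin 1) ℚ), 1 - X 0]
  convert h using 1
  ext t
  simp only [I01, mem_setOf_eq, Fin.forall_fin_succ, Matrix.cons_val_zero, Matrix.cons_val_succ, map_sub,
    map_one, MvPolynomial.aeval_X, sub_pos, IsEmpty.forall_iff, and_true]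

/-- `J` is measurable. [bookkeeping] -/
lemma measurableSet_J : MeasurableSet J := isSemialgebraic_J.measurableSet_holds

/-- `t ∈ J ↔ 0 < t < √2`. [bookkeeping] -/
lemma mem_J_iff {t : Fin 1 → ℝ} : t ∈ J ↔ 0 < t 0 ∧ t 0 < Real.sqrt 2 := by
  simp only [J, mem_setOf_eq]
  constructor
  · rintro ⟨h0, h1⟩
    exact ⟨h0, Real.lt_sqrt_of_sq_lt h1⟩
  · rintro ⟨h0, h1⟩
    refine ⟨h0, ?_⟩
    have h2 : t 0 ^ 2 < Real.sqrt 2 ^ 2 := by nlinarith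
    rwa [Real.sq_sqrt (by norm_num : (0:ℝ) ≤ 2)] at h2

/-- `J ⊆ [0,2]`. [bookkeeping] -/
lemma J_subset_Icc : J ⊆ Set.Icc (fun _ => (0:ℝ)) (fun _ => 2) := by
  intro t ht
  obtain ⟨h0, h1⟩ := ht
  have h2 : t 0 < 2 := by nlinarith
  refine ⟨fun i => ?_, fun i => ?_⟩ <;> fin_cases i
  · exact h0.le
  · exact h2.le

/-- `(0,1) ⊆ [0,1]`. [bookkeeping] -/
lemma I01_subset_Icc : I01 ⊆ Set.Icc (fun _ => (0:ℝ)) (fun _ => 1) := by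
  intro t ht
  obtain ⟨h0, h1⟩ := ht
  refine ⟨fun i => ?_, fun i => ?_⟩ <;> fin_cases i
  · exact h0.le
  · exact h1.le

/-- A rational function continuous on a box around the domain is integrable on it. -/
lemma integrableOn_of_continuousOn_Icc {f : (Fin 1 → ℝ) → ℝ} {s : Set (Fin 1 → ℝ)} {a b : Fin 1 → ℝ}
    (hs : s ⊆ Set.Icc a b) (hf : ContinuousOn f (Set.Icc a b)) :
    IntegrableOn f s := by
  have h : IntegrableOn f (Set.Icc a b) volume := hf.integrableOn_compact isCompact_Icc
  exact h.mono_set hs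

/-- `A := [(0,√2), dt]` (value `√2`). -/
def A : KZ.IntegralRep 1 :=
  KZ.IntegralRep.ofRational J 1 1 isSemialgebraic_J (fun t _ => by simp)
    (by rw [empty_aux]; exact integrableOn_of_continuousOn_Icc J_subset_Icc continuousOn_const)

/-- Integrand of `B` as a function (`1/(1+t)`). [bookkeeping] -/
lemma B_aux : (fun t : Fin 1 → ℝ => aeval t (1 : MvPolynomial (Fin 1) ℚ) / aeval t (1 + X 0 : MvPolynomial (Fin 1) ℚ)) =
    fun t => 1 / (1 + t 0) := by
  funext t; simp

/-- `B := [(0,1), ds/(1+s)]` (value `log 2`). -/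
def B : KZ.IntegralRep 1 :=
  KZ.IntegralRep.ofRational I01 1 (1 + X 0) isSemialgebraic_I01
    (fun t ht => by have := ht.1; simp only [map_add, map_one, MvPolynomial.aeval_X, ne_eq]; linarith)
    (by
      rw [B_aux]
      refine integrableOn_of_continuousOn_Icc I01_subset_Icc ?_
      refine continuousOn_const.div (continuousOn_const.add (continuous_apply 0).continuousOn) ?_
      intro t ht
      have := ht.1 0
      change 0 ≤ t 0 at this
      change 1 + t 0 ≠ 0
      linarith)

/-- Integrand of `W` as a function (`2t/(t²+2)`). [bookkeeping] -/
lemma W_aux : (fun t : Fin 1 → ℝ => aeval t (C 2 * X 0 : MvPolynomial (Fin 1) ℚ) / aeval t (X 0 ^ 2 + C 2 : MvPolynomial (Fin 1) ℚ)) =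
    fun t => 2 * t 0 / (t 0 ^ 2 + 2) := by
  funext t; simp

/-- `W := [(0,√2), 2t dt/(t²+2)]` (value `log 2`). -/
def W : KZ.IntegralRep 1 :=
  KZ.IntegralRep.ofRational J (C 2 * X 0) (X 0 ^ 2 + C 2) isSemialgebraic_J
    (fun t _ => by simp only [map_add, map_pow, MvPolynomial.aeval_X, MvPolynomial.aeval_C, eq_ratCast]; positivity)
    (by
      rw [W_aux]
      refine integrableOn_of_continuousOn_Icc J_subset_Icc ?_
      refine (continuousOn_const.mul (continuous_apply 0).continuousOn).div
        (((continuous_apply 0).continuousOn.pow 2).add continuousOn_const) fun t _ => by positivity)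

/-- Integrand of `G` as a function (`(t²+2t+2)/(t²+2)`). [bookkeeping] -/
lemma G_aux : (fun t : Fin 1 → ℝ => aeval t (X 0 ^ 2 + C 2 * X 0 + C 2 : MvPolynomial (Fin 1) ℚ) /
    aeval t (X 0 ^ 2 + C 2 : MvPolynomial (Fin 1) ℚ)) = fun t => (t 0 ^ 2 + 2 * t 0 + 2) / (t 0 ^ 2 + 2) := by
  funext t; simp

/-- `G := [(0,√2), (t²+2t+2) dt/(t²+2)]` — the merged KZ-rational representative (value `√2 + log 2`). -/
def G : KZ.IntegralRep 1 :=
  KZ.IntegralRep.ofRational J (X 0 ^ 2 + C 2 * X 0 + C 2) (X 0 ^ 2 + C 2) isSemialgebraic_J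
    (fun t _ => by simp only [map_add, map_pow, MvPolynomial.aeval_X, MvPolynomial.aeval_C, eq_ratCast]; positivity)
    (by
      rw [G_aux]
      refine integrableOn_of_continuousOn_Icc J_subset_Icc ?_
      refine ContinuousOn.div ?_ (((continuous_apply 0).continuousOn.pow 2).add continuousOn_const)
        fun t _ => by positivity
      exact (((continuous_apply 0).continuousOn.pow 2).add
        (continuousOn_const.mul (continuous_apply 0).continuousOn)).add continuousOn_const)

/-- `A` is KZ-rational. [bookkeeping] -/
lemma isRational_A : A.IsRational := KZ.IntegralRep.isRational_ofRational _ _ _ _ _ _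
/-- `B` is KZ-rational. [bookkeeping] -/
lemma isRational_B : B.IsRational := KZ.IntegralRep.isRational_ofRational _ _ _ _ _ _
/-- `G` is KZ-rational. [bookkeeping] -/
lemma isRational_G : G.IsRational := KZ.IntegralRep.isRational_ofRational _ _ _ _ _ _

/-- `A.domain = J`. [bookkeeping] -/
lemma domain_A : A.domain = J := rfl
/-- `W.domain = J`. [bookkeeping] -/
lemma domain_W : W.domain = J := rfl
/-- `G.domain = J`. [bookkeeping] -/
lemma domain_G : G.domain = J := rfl
/-- `B.domain = (0,1)`. [bookkeeping] -/
lemma domain_B : B.domain = I01 := rfl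
/-- `A.integrand = 1`. [bookkeeping] -/
lemma integrand_A : A.integrand = fun _ => (1:ℝ) := by rw [A, KZ.IntegralRep.integrand_ofRational, empty_aux]
/-- `B.integrand = 1/(1+t)`. [bookkeeping] -/
lemma integrand_B : B.integrand = fun t => 1 / (1 + t 0) := by rw [B, KZ.IntegralRep.integrand_ofRational, B_aux]
/-- `W.integrand = 2t/(t²+2)`. [bookkeeping] -/
lemma integrand_W : W.integrand = fun t => 2 * t 0 / (t 0 ^ 2 + 2) := by
  rw [W, KZ.IntegralRep.integrand_ofRational, W_aux]
/-- `G.integrand = (t²+2t+2)/(t²+2)`. [bookkeeping] -/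
lemma integrand_G : G.integrand = fun t => (t 0 ^ 2 + 2 * t 0 + 2) / (t 0 ^ 2 + 2) := by
  rw [G, KZ.IntegralRep.integrand_ofRational, G_aux]

/-- Rule 1b on the common domain `(0,√2)`: `[G] − [A] − [W] ∈ KZ.relations`. -/
theorem G_sub_A_sub_W_mem : of G - of A - of W ∈ KZ.relations := by
  refine integrandAddRel_subset_relations ⟨1, G, A, W, domain_A.trans domain_G.symm,
    domain_W.trans domain_G.symm, fun t _ => ?_, rfl⟩
  simp only [Pi.add_apply, integrand_G, integrand_A, integrand_W]
  have h : (t 0 ^ 2 + 2 : ℝ) ≠ 0 := by positivity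
  field_simp
  ring

/-- The substitution chart `Φ(t) = t²/2` on `J = (0,√2)`: semialgebraic, derivative `t`, injective,
image `(0,1)`. -/
theorem exists_squareChart :
    ∃ (Φ : (Fin 1 → ℝ) → (Fin 1 → ℝ)) (Φ' : (Fin 1 → ℝ) → (Fin 1 → ℝ) →L[ℝ] (Fin 1 → ℝ)),
      (∀ t, Φ t 0 = 2⁻¹ * t 0 ^ 2) ∧ IsSemialgebraicMapOn ℚ J Φ ∧ (∀ t, HasFDerivAt Φ (Φ' t) t) ∧
      Set.InjOn Φ J ∧ Φ '' J = I01 ∧ (∀ t, (Φ' t).det = t 0) := by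
  set Φ : (Fin 1 → ℝ) → (Fin 1 → ℝ) := fun t => ![2⁻¹ * t 0 ^ 2] with hΦ
  set Φ' : (Fin 1 → ℝ) → (Fin 1 → ℝ) →L[ℝ] (Fin 1 → ℝ) :=
    fun t => LinearMap.toContinuousLinearMap (Matrix.toLin' !![t 0]) with hΦ'
  have hΦ0 : ∀ t, Φ t 0 = 2⁻¹ * t 0 ^ 2 := fun t => rfl
  have hΦ'0 : ∀ t v : Fin 1 → ℝ, Φ' t v 0 = t 0 * v 0 := by
    intro t v
    change Matrix.toLin' !![t 0] v 0 = _
    rw [Matrix.toLin'_apply]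
    simp [Matrix.mulVec, dotProduct]
  have hdet : ∀ t, (Φ' t).det = t 0 := by
    intro t
    change LinearMap.det (Matrix.toLin' !![t 0]) = _
    rw [LinearMap.det_toLin', Matrix.det_fin_one]
    simp
  have hderiv : ∀ t, HasFDerivAt Φ (Φ' t) t := by
    intro t
    have h0 : HasFDerivAt (fun y : Fin 1 → ℝ => y 0)
        (ContinuousLinearMap.proj (R := ℝ) (φ := fun _ : Fin 1 => ℝ) 0) t := hasFDerivAt_apply 0 t
    rw [hasFDerivAt_pi']
    intro i
    fin_cases i
    have hf : (fun y : Fin 1 → ℝ => Φ y 0) = fun y => 2⁻¹ * y 0 ^ 2 := funext fun y => rfl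
    change HasFDerivAt (fun y : Fin 1 → ℝ => Φ y 0) ((ContinuousLinearMap.proj 0).comp (Φ' t)) t
    rw [hf]
    refine ((h0.pow 2).const_mul 2⁻¹).congr_fderiv (ContinuousLinearMap.ext fun v => ?_)
    simp [hΦ'0]
    ring
  refine ⟨Φ, Φ', hΦ0, ?_, hderiv, ?_, ?_, hdet⟩
  · convert isSemialgebraicMapOn_aeval isSemialgebraic_J ![(C (1/2) * X 0 ^ 2 : MvPolynomial (Fin 1) ℚ)]
      using 2 with t
    funext i
    fin_cases i
    simp [hΦ0]
  · intro x hx y hy hxy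
    have e0 := congrFun hxy 0
    simp only [hΦ0] at e0
    have hx0 : 0 < x 0 := hx.1
    have hy0 : 0 < y 0 := hy.1
    have : x 0 = y 0 := by nlinarith
    funext i
    fin_cases i
    exact this
  · ext s
    constructor
    · rintro ⟨t, ht, rfl⟩
      rw [mem_J_iff] at ht
      obtain ⟨h0, h1⟩ := ht
      have h2 : t 0 ^ 2 < 2 := by
        have := Real.sq_sqrt (show (0:ℝ) ≤ 2 by norm_num)
        nlinarith
      change 0 < 2⁻¹ * t 0 ^ 2 ∧ 2⁻¹ * t 0 ^ 2 < 1
      exact ⟨by positivity, by linarith⟩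
    · rintro ⟨h0, h1⟩
      refine ⟨![Real.sqrt (2 * s 0)], ?_, ?_⟩
      · rw [mem_J_iff]
        simp only [Matrix.cons_val_zero]
        refine ⟨Real.sqrt_pos.2 (by linarith), ?_⟩
        exact Real.sqrt_lt_sqrt (by linarith) (by linarith)
      · funext i
        fin_cases i
        change 2⁻¹ * Real.sqrt (2 * s 0) ^ 2 = s 0
        rw [Real.sq_sqrt (by linarith)]
        ring

/-- Rule 2 along the `ℚ`-rational substitution `s = t²/2`: `[W] − [B] ∈ KZ.relations`. -/
theorem W_sub_B_mem : of W - of B ∈ KZ.relations := by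
  obtain ⟨Φ, Φ', hΦ0, hsa, hderiv, hinj, himage, hdet⟩ := exists_squareChart
  have hd : B.domain = Φ '' W.domain := by rw [domain_B, domain_W, himage]
  refine changeOfVariablesRel_subset_relations ⟨1, W, B, Φ, Φ', hsa,
    fun t _ => (hderiv t).hasFDerivWithinAt, hinj, hd, fun t ht => ?_, rfl⟩
  have h0 : 0 < t 0 := ht.1
  rw [integrand_W, integrand_B]
  simp only [hdet, hΦ0, abs_of_pos h0]
  have h : (t 0 ^ 2 + 2 : ℝ) ≠ 0 := by positivity
  have h' : (1 + 2⁻¹ * t 0 ^ 2 : ℝ) ≠ 0 := by positivity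
  field_simp
  ring

/-- **Toy FixedDimMerge(1).** `[A] + [B] − [G] ∈ KZ.relations`. -/
theorem toyMerge : of A + of B - of G ∈ KZ.relations := by
  have h1 := G_sub_A_sub_W_mem
  have h2 := W_sub_B_mem
  have e : of A + of B - of G = -(of G - of A - of W) - (of W - of B) := by abel
  rw [e]
  exact sub_mem (neg_mem h1) h2

/-- The merged representative has the summed value (soundness). -/
theorem value_G : G.value = A.value + B.value := by
  have h0 := (AddMonoidHom.mem_ker).mp (KZ.relations_le_ker_eval_holds toyMerge)
  simp only [map_sub, map_add, KZ.eval_of] at h0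
  linarith


/-- The toy merge in the shape of `FixedDimMerge 1` for the pair `(A, B)`. -/
theorem fixedDimMerge_instance :
    ∃ (k : ℕ) (G' : KZ.IntegralRep k), k ≤ 1 ∧ G'.IsRational ∧ of A + of B - of G' ∈ KZ.relations :=
  ⟨1, G, le_rfl, isRational_G, toyMerge⟩

end Toy

end Summit.KontsevichZagierPeriods.KontsevichZagierPeriods.Theorems.RootDecompQuadraticDescentMerge
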